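import Summits.QuantumFields.YangMills.Theorems.BalabanLadderIRAfOnsetLargeUnit

/-!
# Crux `IR` (stmt-QuantumFields-19354), line `af-pincer`, stub `stub_afOnsetUc : AFToOnsetUKPc` (X-side):
# scale-uniform lattice Riemann sums in every dimension and one-dimensional telescoping sums

Helper for the X-stub of slot `af-pincer-Uc` (seat ym-19354-afpincer-s2, generation 2), first of the chain
`…AfOnsetRiemannSums → …AfOnsetSliceSums → …AfOnsetDoubleSums / …AfOnsetTails → IR/AfPincerUcXCov` which reduces cplan
g10's S2 done-when `AFBelowScaleAt G r ℓ` («`|Q2 G r β L s (θv) v| ≤ η` at units `s ≥ T(η)/ℓ(β)`») to COVARIANCE-LEVEL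
hypotheses (an asymptotic-freedom window `|Cov_{β,L}(A_x,A_y)| ≤ W (1+‖x−y‖)⁻⁸` for `T'(W)‖x−y‖ ≤ ℓ(β)` and a crossover
envelope `≤ W₀ (1+‖x−y‖)⁻⁸`).  The BARE sums `Q2 = Σ_{x,y ∈ box L} θv(s x) v(s y) Cov` have `≍ s⁻⁸` pairs; their control
uniformly in the unit rests on the two elementary tools of this file:

* §1 `sum_decay_le_dim` — the tree's `a`-uniform bound `Σ_{z ∈ ℤᵈ} aᵈ (1 + a‖z‖)⁻ᵖ ≤ 3ᵈ Σ (m+1)⁻²` (`0 < a ≤ 1`,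
  `p ≥ d + 2`; `OSLegsFromFemtoAndGap.sum_decay_le` is `d = 4`) in every dimension `d`, its any-scale form
  `sum_inv_pow_le_dim` (`Σ (1 + a‖z‖)⁻ᵖ ≤ 3ᵈ Σ(m+1)⁻² / min(a,1)ᵈ`) and the shifted transverse form in `ℤ³`
  `sum_inv_pow_shift_le` (`Σ_z (1 + m + ‖c − z‖)⁻⁶ ≤ 27 Σ(k+1)⁻² / (1+m)³`);
* §2 `sum_div_one_add_mul_sq_le` (`Σ_b s/(1+s b)² ≤ 1` over positive integers, telescoping), `sum_cube_div_le`
  (`Σ_b s³/(1+s b)³ ≤ s²`), `sum_cube_mul_div_le` (`Σ_b s³ b/(1+s b)³ ≤ s`).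

HONEST FRAMING.  Elementary real analysis (folklore); nothing about Yang–Mills is asserted; one open stub of one open
gap-crux of a CONDITIONAL chain (Track A 0/28 UV); not a gap claim.
-/

set_option autoImplicit false

noncomputable section

open Filter Topology Finset
open scoped BigOperators
open Literature.MathematicalPhysics.QuantumLattice
open Literature.Probability.LatticeModels (Site box mem_box)
open Summit.QuantumFields.YangMills.Theorems.OSLegsFromFemtoAndGap (summable_inv_succ_sq mul_norm_le_norm_smul_siteToE)

namespace Summit.QuantumFields.YangMills.Cruxes.IR.AfOnset

/-! ## §1 Riemann sums of `(1 + a‖z‖)⁻ᵖ` over `ℤᵈ`, uniformly in the scale -/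
section Riemann

variable {d : ℕ}

/-- Sites of `ℤᵈ` of sup norm `< (m+1)/a` lie in the cube of half-side `⌊(m+1)/a⌋₊`. [folklore] -/
theorem mem_piFinset_of_norm_lt_dim {a : ℝ} (ha : 0 < a) {m : ℕ} {z : Site d}
    (hz : a * ‖z‖ < m + 1) :
    z ∈ Fintype.piFinset fun _ : Fin d => Finset.Icc (-(⌊((m : ℝ) + 1) / a⌋₊ : ℤ)) ⌊((m : ℝ) + 1) / a⌋₊ := by
  rw [Fintype.mem_piFinset]
  intro k
  have hzk : ‖z k‖ ≤ ‖z‖ := norm_le_pi_norm z k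
  have h1 : (‖z k‖ : ℝ) < (m + 1) / a := by
    rw [lt_div_iff₀ ha]; nlinarith
  have h2 : |z k| ≤ (⌊((m : ℝ) + 1) / a⌋₊ : ℤ) := by
    have h3 : ((|z k| : ℤ) : ℝ) < (m + 1) / a := by
      rw [Int.cast_abs]; simpa [Int.norm_eq_abs] using h1
    have h4 : (|z k| : ℤ) ≤ ⌊((m : ℝ) + 1) / a⌋ := Int.le_floor.2 h3.le
    have h5 : (⌊((m : ℝ) + 1) / a⌋ : ℤ) = ((⌊((m : ℝ) + 1) / a⌋₊ : ℕ) : ℤ) := by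
      rw [Int.natCast_floor_eq_floor]
      positivity
    rw [← h5]; exact h4
  rw [Finset.mem_Icc]
  constructor <;> linarith [abs_le.1 h2 |>.1, abs_le.1 h2 |>.2]

/-- The cube of half-side `K` in `ℤᵈ` has `(2K+1)ᵈ` sites. [folklore] -/
theorem card_piFinset_Icc_dim (K : ℕ) :
    #(Fintype.piFinset fun _ : Fin d => Finset.Icc (-(K : ℤ)) K) = (2 * K + 1) ^ d := by
  rw [Fintype.card_piFinset, Finset.prod_const, Finset.card_univ, Fintype.card_fin]
  congr 1
  rw [Int.card_Icc]
  omega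

/-- **`a`-uniform lattice Riemann-sum bound in dimension `d`.** For `0 < a ≤ 1`, `d + 2 ≤ p` and every finite set of
sites of `ℤᵈ`: `∑_{z ∈ T} aᵈ (1 + a‖z‖)⁻ᵖ ≤ 3ᵈ ∑' m, ((m+1)²)⁻¹` (fibre by `⌊a‖z‖⌋₊`; the tree's `sum_decay_le` is the
case `d = 4`). [folklore] -/
theorem sum_decay_le_dim {a : ℝ} (ha : 0 < a) (ha1 : a ≤ 1) {p : ℕ} (hp : d + 2 ≤ p) (T : Finset (Site d)) :
    ∑ z ∈ T, a ^ d * ((1 + a * ‖z‖) ^ p)⁻¹ ≤ 3 ^ d * ∑' m : ℕ, (((m : ℝ) + 1) ^ 2)⁻¹ := by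
  classical
  set μ : Site d → ℕ := fun z => ⌊a * ‖z‖⌋₊ with hμ
  have hnn : ∀ z : Site d, 0 ≤ a * ‖z‖ := fun z => mul_nonneg ha.le (norm_nonneg _)
  rw [← Finset.sum_fiberwise_of_maps_to (g := μ) (t := T.image μ) (fun z hz => Finset.mem_image_of_mem μ hz)]
  have hfib : ∀ m ∈ T.image μ, ∑ z ∈ T.filter (fun z => μ z = m), a ^ d * ((1 + a * ‖z‖) ^ p)⁻¹ ≤
      3 ^ d * (((m : ℝ) + 1) ^ 2)⁻¹ := by
    intro m _
    have hterm : ∀ z ∈ T.filter (fun z => μ z = m), a ^ d * ((1 + a * ‖z‖) ^ p)⁻¹ ≤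
        a ^ d * (((m : ℝ) + 1) ^ p)⁻¹ := by
      intro z hz
      rw [Finset.mem_filter] at hz
      have hmz : (m : ℝ) ≤ a * ‖z‖ := by rw [← hz.2]; exact Nat.floor_le (hnn z)
      have hpow : ((m : ℝ) + 1) ^ p ≤ (1 + a * ‖z‖) ^ p := pow_le_pow_left₀ (by positivity) (by linarith) p
      exact mul_le_mul_of_nonneg_left (inv_anti₀ (by positivity) hpow) (by positivity)
    have hsub : T.filter (fun z => μ z = m) ⊆
        Fintype.piFinset fun _ : Fin d => Finset.Icc (-(⌊((m : ℝ) + 1) / a⌋₊ : ℤ)) ⌊((m : ℝ) + 1) / a⌋₊ := by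
      intro z hz
      rw [Finset.mem_filter] at hz
      refine mem_piFinset_of_norm_lt_dim ha ?_
      have h' : a * ‖z‖ < (μ z : ℝ) + 1 := Nat.lt_floor_add_one (a * ‖z‖)
      rw [hz.2] at h'
      exact h'
    have hcard : (#(T.filter fun z => μ z = m) : ℝ) ≤ (3 * ((m : ℝ) + 1) / a) ^ d := by
      have h1 := Finset.card_le_card hsub
      rw [card_piFinset_Icc_dim] at h1
      have h2 : ((2 * ⌊((m : ℝ) + 1) / a⌋₊ + 1 : ℕ) : ℝ) ≤ 3 * ((m : ℝ) + 1) / a := by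
        have hfl : (⌊((m : ℝ) + 1) / a⌋₊ : ℝ) ≤ ((m : ℝ) + 1) / a := Nat.floor_le (by positivity)
        have h1a : (1 : ℝ) ≤ ((m : ℝ) + 1) / a := by
          rw [le_div_iff₀ ha]; nlinarith
        have h3 : 3 * ((m : ℝ) + 1) / a = 3 * (((m : ℝ) + 1) / a) := by ring
        rw [h3]; push_cast; linarith
      calc (#(T.filter fun z => μ z = m) : ℝ) ≤ ((2 * ⌊((m : ℝ) + 1) / a⌋₊ + 1) ^ d : ℕ) := by exact_mod_cast h1
        _ = (((2 * ⌊((m : ℝ) + 1) / a⌋₊ + 1 : ℕ) : ℝ)) ^ d := by push_cast; ring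
        _ ≤ (3 * ((m : ℝ) + 1) / a) ^ d := by gcongr
    have hm1 : (1 : ℝ) ≤ (m : ℝ) + 1 := by linarith [(Nat.cast_nonneg m : (0 : ℝ) ≤ m)]
    calc ∑ z ∈ T.filter (fun z => μ z = m), a ^ d * ((1 + a * ‖z‖) ^ p)⁻¹
        ≤ ∑ z ∈ T.filter (fun z => μ z = m), a ^ d * (((m : ℝ) + 1) ^ p)⁻¹ := Finset.sum_le_sum hterm
      _ = #(T.filter fun z => μ z = m) * (a ^ d * (((m : ℝ) + 1) ^ p)⁻¹) := by
          rw [Finset.sum_const, nsmul_eq_mul]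
      _ ≤ (3 * ((m : ℝ) + 1) / a) ^ d * (a ^ d * (((m : ℝ) + 1) ^ p)⁻¹) := by gcongr
      _ = 3 ^ d * (((m : ℝ) + 1) ^ d * (((m : ℝ) + 1) ^ p)⁻¹) := by
          rw [div_pow, mul_pow]
          field_simp
      _ ≤ 3 ^ d * (((m : ℝ) + 1) ^ 2)⁻¹ := by
          gcongr
          obtain ⟨q, rfl⟩ : ∃ q, p = q + d := ⟨p - d, by omega⟩
          have key : ((m : ℝ) + 1) ^ d * (((m : ℝ) + 1) ^ (q + d))⁻¹ = (((m : ℝ) + 1) ^ q)⁻¹ := by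
            rw [pow_add]
            field_simp
          rw [key]
          exact inv_anti₀ (by positivity) (pow_le_pow_right₀ hm1 (by omega))
  calc ∑ m ∈ T.image μ, ∑ z ∈ T.filter (fun z => μ z = m), a ^ d * ((1 + a * ‖z‖) ^ p)⁻¹
      ≤ ∑ m ∈ T.image μ, 3 ^ d * (((m : ℝ) + 1) ^ 2)⁻¹ := Finset.sum_le_sum hfib
    _ = 3 ^ d * ∑ m ∈ T.image μ, (((m : ℝ) + 1) ^ 2)⁻¹ := by rw [Finset.mul_sum]
    _ ≤ 3 ^ d * ∑' m : ℕ, (((m : ℝ) + 1) ^ 2)⁻¹ := by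
        gcongr
        exact Summable.sum_le_tsum _ (fun m _ => by positivity) summable_inv_succ_sq

/-- The Riemann-sum constant `3ᵈ Σ (m+1)⁻²` is nonnegative. [folklore] -/
theorem riemann_const_nonneg (d : ℕ) : (0 : ℝ) ≤ 3 ^ d * ∑' m : ℕ, (((m : ℝ) + 1) ^ 2)⁻¹ := by
  have : 0 ≤ ∑' m : ℕ, (((m : ℝ) + 1) ^ 2)⁻¹ := tsum_nonneg fun m => by positivity
  positivity

/-- **Any scale**: `∑_{z ∈ T} (1 + a‖z‖)⁻ᵖ ≤ 3ᵈ Σ(m+1)⁻² / min(a,1)ᵈ` for `0 < a`, `d + 2 ≤ p`. [folklore] -/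
theorem sum_inv_pow_le_dim {a : ℝ} (ha : 0 < a) {p : ℕ} (hp : d + 2 ≤ p) (T : Finset (Site d)) :
    ∑ z ∈ T, ((1 + a * ‖z‖) ^ p)⁻¹ ≤ (3 ^ d * ∑' m : ℕ, (((m : ℝ) + 1) ^ 2)⁻¹) / (min a 1) ^ d := by
  set a' : ℝ := min a 1 with ha'
  have ha'0 : 0 < a' := lt_min ha one_pos
  have ha'1 : a' ≤ 1 := min_le_right _ _
  have ha'a : a' ≤ a := min_le_left _ _
  have hterm : ∀ z ∈ T, ((1 + a * ‖z‖) ^ p)⁻¹ ≤ (a' ^ d)⁻¹ * (a' ^ d * ((1 + a' * ‖z‖) ^ p)⁻¹) := by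
    intro z _
    have h1 : ((1 + a * ‖z‖) ^ p)⁻¹ ≤ ((1 + a' * ‖z‖) ^ p)⁻¹ := by
      refine inv_anti₀ (by positivity) (pow_le_pow_left₀ (by positivity) ?_ p)
      nlinarith [norm_nonneg z]
    have h2 : (a' ^ d)⁻¹ * (a' ^ d * ((1 + a' * ‖z‖) ^ p)⁻¹) = ((1 + a' * ‖z‖) ^ p)⁻¹ := by
      field_simp
    rw [h2]; exact h1
  calc ∑ z ∈ T, ((1 + a * ‖z‖) ^ p)⁻¹ ≤ ∑ z ∈ T, (a' ^ d)⁻¹ * (a' ^ d * ((1 + a' * ‖z‖) ^ p)⁻¹) :=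
        Finset.sum_le_sum hterm
    _ = (a' ^ d)⁻¹ * ∑ z ∈ T, a' ^ d * ((1 + a' * ‖z‖) ^ p)⁻¹ := by rw [Finset.mul_sum]
    _ ≤ (a' ^ d)⁻¹ * (3 ^ d * ∑' m : ℕ, (((m : ℝ) + 1) ^ 2)⁻¹) :=
        mul_le_mul_of_nonneg_left (sum_decay_le_dim ha'0 ha'1 hp T) (by positivity)
    _ = (3 ^ d * ∑' m : ℕ, (((m : ℝ) + 1) ^ 2)⁻¹) / a' ^ d := by rw [inv_mul_eq_div]

/-- **Shifted transverse sum in `ℤ³`**: `∑_{z ∈ T} (1 + m + ‖c − z‖)⁻⁶ ≤ 27 Σ(k+1)⁻² / (1 + m)³` for `0 ≤ m`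
(§1 at scale `1/(1+m)` after the reflection `z ↦ c − z`). [folklore] -/
theorem sum_inv_pow_shift_le (c : Site 3) {m : ℝ} (hm : 0 ≤ m) (T : Finset (Site 3)) :
    ∑ z ∈ T, ((1 + m + ‖c - z‖) ^ 6)⁻¹ ≤ (3 ^ 3 * ∑' k : ℕ, (((k : ℝ) + 1) ^ 2)⁻¹) / (1 + m) ^ 3 := by
  classical
  have hinj : Set.InjOn (fun z : Site 3 => c - z) ↑T := fun z _ w _ h => sub_right_injective h
  have hre : ∑ z ∈ T, ((1 + m + ‖c - z‖) ^ 6)⁻¹ = ∑ w ∈ T.image (fun z => c - z), ((1 + m + ‖w‖) ^ 6)⁻¹ := by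
    rw [Finset.sum_image hinj]
  rw [hre]
  set α : ℝ := (1 + m)⁻¹ with hα
  have h1m : 0 < 1 + m := by linarith
  have hα0 : 0 < α := inv_pos.2 h1m
  have hα1 : α ≤ 1 := inv_le_one_of_one_le₀ (by linarith)
  have hterm : ∀ w : Site 3, ((1 + m + ‖w‖) ^ 6)⁻¹ = ((1 + m) ^ 3)⁻¹ * (α ^ 3 * ((1 + α * ‖w‖) ^ 6)⁻¹) := by
    intro w
    have h1 : 1 + m + ‖w‖ = (1 + m) * (1 + α * ‖w‖) := by
      rw [hα]; field_simp
    rw [h1, mul_pow, hα, inv_pow]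
    have h2 : (1 + m) ^ 6 = (1 + m) ^ 3 * (1 + m) ^ 3 := by ring
    rw [h2]
    field_simp
  calc ∑ w ∈ T.image (fun z => c - z), ((1 + m + ‖w‖) ^ 6)⁻¹
      = ∑ w ∈ T.image (fun z => c - z), ((1 + m) ^ 3)⁻¹ * (α ^ 3 * ((1 + α * ‖w‖) ^ 6)⁻¹) :=
        Finset.sum_congr rfl fun w _ => hterm w
    _ = ((1 + m) ^ 3)⁻¹ * ∑ w ∈ T.image (fun z => c - z), α ^ 3 * ((1 + α * ‖w‖) ^ 6)⁻¹ := by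
        rw [Finset.mul_sum]
    _ ≤ ((1 + m) ^ 3)⁻¹ * (3 ^ 3 * ∑' k : ℕ, (((k : ℝ) + 1) ^ 2)⁻¹) :=
        mul_le_mul_of_nonneg_left (sum_decay_le_dim hα0 hα1 (by norm_num) _) (by positivity)
    _ = (3 ^ 3 * ∑' k : ℕ, (((k : ℝ) + 1) ^ 2)⁻¹) / (1 + m) ^ 3 := by rw [inv_mul_eq_div]

end Riemann

/-! ## §2 One-dimensional telescoping sums -/
section OneDim

/-- `∑_{b ∈ B} s / (1 + s b)² ≤ 1` for every finite set `B` of positive integers and every `s > 0`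
(telescoping: `s/(1+s b)² ≤ 1/(1+s(b−1)) − 1/(1+s b)`). [folklore] -/
theorem sum_div_one_add_mul_sq_le {s : ℝ} (hs : 0 < s) (B : Finset ℕ) (hB : ∀ b ∈ B, 1 ≤ b) :
    ∑ b ∈ B, s / (1 + s * b) ^ 2 ≤ 1 := by
  classical
  set N : ℕ := B.sup id with hN
  have hsub : B ⊆ (Finset.range N).image (· + 1) := by
    intro b hb
    rw [Finset.mem_image]
    refine ⟨b - 1, Finset.mem_range.2 ?_, ?_⟩
    · have h1 : b ≤ N := Finset.le_sup (f := id) hb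
      have h2 := hB b hb
      omega
    · have h2 := hB b hb
      omega
  have hnonneg : ∀ b ∈ (Finset.range N).image (· + 1), b ∉ B → 0 ≤ s / (1 + s * (b : ℝ)) ^ 2 :=
    fun b _ _ => by positivity
  refine (Finset.sum_le_sum_of_subset_of_nonneg hsub hnonneg).trans ?_
  rw [Finset.sum_image fun i _ j _ h => by simpa using h]
  set f : ℕ → ℝ := fun i => 1 / (1 + s * i) with hf
  have hstep : ∀ i ∈ Finset.range N, s / (1 + s * ((i + 1 : ℕ) : ℝ)) ^ 2 ≤ f i - f (i + 1) := by
    intro i _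
    have hi0 : (0 : ℝ) ≤ i := Nat.cast_nonneg i
    have h1 : 0 < 1 + s * (i : ℝ) := by positivity
    have h2 : 0 < 1 + s * ((i : ℝ) + 1) := by positivity
    have hdiff : f i - f (i + 1) = s / ((1 + s * i) * (1 + s * ((i : ℝ) + 1))) := by
      simp only [hf]
      push_cast
      field_simp
      ring
    rw [hdiff]
    push_cast
    refine div_le_div_of_nonneg_left hs.le (by positivity) ?_
    have h3 : 1 + s * (i : ℝ) ≤ 1 + s * ((i : ℝ) + 1) := by nlinarith
    calc (1 + s * (i : ℝ)) * (1 + s * ((i : ℝ) + 1)) ≤ (1 + s * ((i : ℝ) + 1)) * (1 + s * ((i : ℝ) + 1)) :=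
          mul_le_mul_of_nonneg_right h3 h2.le
      _ = (1 + s * ((i : ℝ) + 1)) ^ 2 := by ring
  refine (Finset.sum_le_sum hstep).trans ?_
  rw [Finset.sum_range_sub']
  have hf0 : f 0 = 1 := by simp [hf]
  have hfN : 0 ≤ f N := by simp only [hf]; positivity
  linarith

/-- `∑_{b ∈ B} s³ / (1 + s b)³ ≤ s²` (positive integers `b`, `s > 0`). [folklore] -/
theorem sum_cube_div_le {s : ℝ} (hs : 0 < s) (B : Finset ℕ) (hB : ∀ b ∈ B, 1 ≤ b) :
    ∑ b ∈ B, s ^ 3 / (1 + s * b) ^ 3 ≤ s ^ 2 := by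
  have hterm : ∀ b ∈ B, s ^ 3 / (1 + s * (b : ℝ)) ^ 3 ≤ s ^ 2 * (s / (1 + s * b) ^ 2) := by
    intro b _
    have hb0 : (0 : ℝ) ≤ b := Nat.cast_nonneg b
    have h1 : 1 ≤ 1 + s * (b : ℝ) := by nlinarith
    have h2 : 0 < 1 + s * (b : ℝ) := by positivity
    rw [div_le_iff₀ (by positivity)]
    calc s ^ 3 = s ^ 2 * (s / (1 + s * b) ^ 2) * ((1 + s * b) ^ 2 * 1) := by field_simp
      _ ≤ s ^ 2 * (s / (1 + s * b) ^ 2) * ((1 + s * b) ^ 2 * (1 + s * b)) := by gcongr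
      _ = s ^ 2 * (s / (1 + s * b) ^ 2) * (1 + s * b) ^ 3 := by ring
  calc ∑ b ∈ B, s ^ 3 / (1 + s * (b : ℝ)) ^ 3 ≤ ∑ b ∈ B, s ^ 2 * (s / (1 + s * b) ^ 2) := Finset.sum_le_sum hterm
    _ = s ^ 2 * ∑ b ∈ B, s / (1 + s * b) ^ 2 := by rw [Finset.mul_sum]
    _ ≤ s ^ 2 * 1 := mul_le_mul_of_nonneg_left (sum_div_one_add_mul_sq_le hs B hB) (by positivity)
    _ = s ^ 2 := mul_one _

/-- `∑_{b ∈ B} s³ b / (1 + s b)³ ≤ s` (positive integers `b`, `s > 0`). [folklore] -/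
theorem sum_cube_mul_div_le {s : ℝ} (hs : 0 < s) (B : Finset ℕ) (hB : ∀ b ∈ B, 1 ≤ b) :
    ∑ b ∈ B, s ^ 3 * b / (1 + s * b) ^ 3 ≤ s := by
  have hterm : ∀ b ∈ B, s ^ 3 * (b : ℝ) / (1 + s * (b : ℝ)) ^ 3 ≤ s * (s / (1 + s * b) ^ 2) := by
    intro b _
    have hb0 : (0 : ℝ) ≤ b := Nat.cast_nonneg b
    have h2 : 0 < 1 + s * (b : ℝ) := by positivity
    have h1 : s * (b : ℝ) ≤ 1 + s * (b : ℝ) := by linarith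
    rw [div_le_iff₀ (by positivity)]
    calc s ^ 3 * (b : ℝ) = s * (s / (1 + s * b) ^ 2) * ((1 + s * b) ^ 2 * (s * b)) := by field_simp
      _ ≤ s * (s / (1 + s * b) ^ 2) * ((1 + s * b) ^ 2 * (1 + s * b)) := by gcongr
      _ = s * (s / (1 + s * b) ^ 2) * (1 + s * b) ^ 3 := by ring
  calc ∑ b ∈ B, s ^ 3 * (b : ℝ) / (1 + s * (b : ℝ)) ^ 3 ≤ ∑ b ∈ B, s * (s / (1 + s * b) ^ 2) :=
        Finset.sum_le_sum hterm
    _ = s * ∑ b ∈ B, s / (1 + s * b) ^ 2 := by rw [Finset.mul_sum]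
    _ ≤ s * 1 := mul_le_mul_of_nonneg_left (sum_div_one_add_mul_sq_le hs B hB) hs.le
    _ = s := mul_one _

end OneDim

end Summit.QuantumFields.YangMills.Cruxes.IR.AfOnset

end
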